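import Literature.Computability.AlgebraicComplexity.LevelTriples
import HarnessLib

/-!
# `Y`-compatibility, `Y`-usefulness and `Y`-typicalness of level-1 `Y`-blocks
(Alman–Duan–Vassilevska Williams–Xu–Xu–Zhou 2025, §5.3 and §5.5: Defs. 5.6, 5.8, 5.13, Claim 5.7,
Claim 5.18) — definitions and proofs

Topic `Literature/Computability/AlgebraicComplexity`.  The global stage of Alman–Duan–Vassilevska
Williams–Xu–Xu–Zhou, *More asymmetry yields faster matrix multiplication* (SODA 2025,
arXiv:2404.16349), §5, differs from that of Vassilevska Williams–Xu–Xu–Zhou 2024 (formalised in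
`LevelTriples.lean`, `GlobalStage*.lean`) in ONE structural point: after the "more asymmetric" hashing
(§5.2, `MoreAsymmetricHashing.lean`) only the level-`ℓ` `X`-blocks lie in unique block triples, so the
level-1 `Y`-blocks must be made unique by the same compatibility / unique-triple / usefulness zero-outs
that VXXZ 2024 apply to the `Z`-blocks (§5.3 "Y-Compatibility Zero-Out", the new step; §5.4 then treats
the `Z`-blocks exactly as VXXZ, Defs. 5.9/5.11 = `IsCompatibleWith`/`IsUsefulFor` of `LevelTriples.lean`).
This file vendors the `Y`-dimension notions of §5.3/§5.5 on top of the position classes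
`S_{i,j,k}` (`posClass`) of `LevelTriples.lean`, and PROVES the two claims about them:

* `posClassY` — **`S_{*,j,*} = {t | J_t = j}`**, with its fibrewise decomposition over `i`
  (`k = 2^ℓ − j − i`; `card_filter_posClassY_eq_sum`) and the averaging identity for split
  distributions (`completeSplitOn_posClassY_mul_card`); `posClassYpos` — **`S_{*,j,+} = ⋃_{k>0} S_{i,j,k}`**
  and the decomposition `S_{*,j,*} = S_{*,j,+} ⊔ S_{2^ℓ−j, j, 0}` (`posClassY_eq_union`);
* `gammaBarY` — **`β̄_{Y,*,j,*}`**, the `α`-weighted average of the `β_{Y,i,j,k}` with middle index `j`;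
  `gammaBarYpos` — **`β̄_{Y,*,j,+}`** (average over `k > 0`);
* `IsTypicalY` — **Def. 5.13** (`split(Ĵ, S_{*,j,*}) = β̄_{Y,*,j,*}` for every `j`);
  `IsYCompatibleWith` — **Def. 5.6** ((1) `split(Ĵ, S_{i,j,k}) = β_{Y,i,j,k}` for `k = 0`; (2) typical);
  **Def. 5.8** (`Y`-usefulness: `split(Ĵ, S_{i,j,k}) = β_{Y,i,j,k}` for all `i,j,k`) is the
  dimension-agnostic `IsUsefulFor β_Y I J K Ĵ` of `LevelTriples.lean`;
* `IsUsefulFor.isTypicalY` — a `Y`-useful block of an `α`-consistent triple is `Y`-typical (proof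
  of Claim 5.12: "condition (3) is strictly stronger than condition (1) because
  `split(Ĵ, S_{*,j,*}) = (1/∑α) ∑ α · split(Ĵ, S_{i,j,k}) = (1/∑α) ∑ α β_{Y,i,j,k} = β̄_{Y,*,j,*}`"),
  hence `Y`-compatible (`IsUsefulFor.isYCompatibleWith`);
* `levelSeq_y_eq_rev_of_chunkLevels_z_eq_zero`, `yCompatible_fst_of_usefulX`, `advxxz2025_claim57` —
  **Claim 5.7**: in the support of `(CW_q^{⊗2^{ℓ−1}})^{⊗n}`, on the chunks `t ∈ S_{i,j,0}` (level-`ℓ`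
  `Z`-index `0`) the level-1 `Ĵ`-chunk is `2⃗ −` the `Î`-chunk, so
  `split(Ĵ, S_{i,j,0})(L) = split(Î, S_{i,j,0})(2⃗ − L) = β_{X,i,j,0}(2⃗ − L) = β_{Y,i,j,0}(L)` once `Î`
  is useful (the first zero-out of §5.3) — under Remark 5.2's convention
  `β_{Y,i,j,0}(L) = β_{X,i,j,0}(2⃗ − L)` — and with the typicality enforced by the `Y`-compatibility
  zero-out I, `Ĵ` is compatible with the triple;
* `advxxz2025_claim518` — **Claim 5.18**: for an `α`-consistent triple, `Ĵ ∈ Y_J` is `Y`-compatible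
  iff (1) holds and `split(Ĵ, S_{*,j,+}) = β̄_{Y,*,j,+}` for every `j` (the form in which `p_compY` is
  counted in Claim 5.17).

Conventions as in `LevelTriples.lean`: conditions on a position class are imposed only when the class
occurs (`split(·, ∅)` is undefined in the paper); the averages run over `i ∈ {0,…,2c}` with
`k = 2c − j − i` truncated in `ℕ`, the extra terms vanishing for `α` supported on `{i + j + k = 2c}`
(forced by `IsAlphaConsistent`).  Everything is proved; the definitions are the paper's; no named facts.

## References

* J. Alman, R. Duan, V. Vassilevska Williams, Y. Xu, Z. Xu, R. Zhou, *More asymmetry yields faster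
  matrix multiplication*, SODA 2025, arXiv:2404.16349 (held: `paper:arxiv-2404.16349`, chunks
  p0016–p0019): §5.3 (`S_{i,j,k}`, `S_{*,j,*}`, the zero-outs, Def. 5.6, Claim 5.7 with proof, Def. 5.8),
  §5.5 (Claim 5.12 (proof), Def. 5.13, Def. 5.15, Claim 5.18), Remark 5.2.
  [AlmanDuanVassilevskaWilliamsXuXuZhou2025]
* V. Vassilevska Williams, Y. Xu, Z. Xu, R. Zhou, *New bounds for matrix multiplication: from alpha
  to omega*, SODA 2024, arXiv:2307.07970, §5.3–§5.6 (the `Z`-dimension originals: Defs. 5.8, 5.10,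
  5.12, Claims 5.9, 5.14). [VassilevskaWilliamsXuXuZhou2024]
-/

noncomputable section

open scoped BigOperators
open Finset

namespace Literature.Computability.AlgebraicComplexity

open Literature.Barriers.MatrixMultiplication (bigCwTensor)

universe u

/-! ## The position classes `S_{*,j,*}` and `S_{*,j,+}` -/

section PosClassY

variable {c n : ℕ}

/-- **`S_{*,j,*} = {t ∈ [n] | J_t = j}`**, the positions of a level-`ℓ` `Y`-block with index `j`.
[cite: AlmanDuanVassilevskaWilliamsXuXuZhou2025, §5.3 (S^{(J)}_{*,j,*})] -/
def posClassY (J : Fin n → ℕ) (j : ℕ) : Finset (Fin n) := univ.filter fun t => J t = j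

/-- **`S_{*,j,+} = ⋃_{i ≥ 0, k > 0} S_{i,j,k}`**. [cite: AlmanDuanVassilevskaWilliamsXuXuZhou2025, Claim 5.18 (S_{*,j,+})] -/
def posClassYpos (J K : Fin n → ℕ) (j : ℕ) : Finset (Fin n) := univ.filter fun t => J t = j ∧ 0 < K t

/-- Membership in `S_{*,j,*}`. [cite: AlmanDuanVassilevskaWilliamsXuXuZhou2025, §5.3] -/
@[simp] theorem mem_posClassY {J : Fin n → ℕ} {j : ℕ} {t : Fin n} : t ∈ posClassY J j ↔ J t = j := by
  simp [posClassY]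

/-- Membership in `S_{*,j,+}`. [cite: AlmanDuanVassilevskaWilliamsXuXuZhou2025, Claim 5.18] -/
@[simp] theorem mem_posClassYpos {J K : Fin n → ℕ} {j : ℕ} {t : Fin n} :
    t ∈ posClassYpos J K j ↔ J t = j ∧ 0 < K t := by
  simp [posClassYpos]

/-- `S_{i,j,k} ⊆ S_{*,j,*}`. [cite: AlmanDuanVassilevskaWilliamsXuXuZhou2025, §5.3] -/
theorem posClass_subset_posClassY (I J K : Fin n → ℕ) (i j k : ℕ) : posClass I J K i j k ⊆ posClassY J j := by
  intro t ht
  rw [mem_posClass] at ht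
  exact mem_posClassY.2 ht.2.1

/-- `S_{*,j,+} ⊆ S_{*,j,*}`. [cite: AlmanDuanVassilevskaWilliamsXuXuZhou2025, Claim 5.18] -/
theorem posClassYpos_subset_posClassY (J K : Fin n → ℕ) (j : ℕ) : posClassYpos J K j ⊆ posClassY J j := by
  intro t ht
  rw [mem_posClassYpos] at ht
  exact mem_posClassY.2 ht.1

/-- In a block triple, the part of `S_{*,j,*}` where `I_t = i` is `S_{i, j, 2c-j-i}`. [cite: AlmanDuanVassilevskaWilliamsXuXuZhou2025, §5.3] -/
theorem filter_posClassY_eq_posClass {I J K : Fin n → ℕ} (h : IsLevelTriple c I J K) (j i : ℕ) :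
    ((posClassY J j).filter fun t => I t = i) = posClass I J K i j (2 * c - j - i) := by
  ext t
  simp only [mem_filter, mem_posClassY, mem_posClass]
  have := h t
  constructor
  · rintro ⟨hj, hi⟩
    exact ⟨hi, hj, by omega⟩
  · rintro ⟨hi, hj, -⟩
    exact ⟨hj, hi⟩

/-- In a block triple, the part of `S_{*,j,+}` where `I_t = i` is `S_{i, j, 2c-j-i}` for `i < 2c − j`
(i.e. `k = 2c − j − i > 0`). [cite: AlmanDuanVassilevskaWilliamsXuXuZhou2025, Claim 5.18] -/
theorem filter_posClassYpos_eq_posClass {I J K : Fin n → ℕ} (h : IsLevelTriple c I J K) (j : ℕ) {i : ℕ}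
    (hi : i < 2 * c - j) :
    ((posClassYpos J K j).filter fun t => I t = i) = posClass I J K i j (2 * c - j - i) := by
  ext t
  simp only [mem_filter, mem_posClassYpos, mem_posClass]
  have := h t
  constructor
  · rintro ⟨⟨hj, hk⟩, hi⟩
    exact ⟨hi, hj, by omega⟩
  · rintro ⟨hi, hj, hk⟩
    exact ⟨⟨hj, by omega⟩, hi⟩

/-- **Fibrewise decomposition of `S_{*,j,*}`**: `#{t ∈ S_{*,j,*} | p t} = ∑_{i ≤ 2c} #{t ∈ S_{i,j,2c-j-i} | p t}`.
[cite: AlmanDuanVassilevskaWilliamsXuXuZhou2025, §5.3 and Claim 5.12 (proof: "split(Ĵ, S_{*,j,*}) = (1/∑α) ∑_{i+j=2^ℓ−k} α · split(Ĵ, S_{i,j,k})")] -/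
theorem card_filter_posClassY_eq_sum {I J K : Fin n → ℕ} (h : IsLevelTriple c I J K) (j : ℕ)
    (p : Fin n → Prop) [DecidablePred p] :
    ((posClassY J j).filter p).card =
      ∑ i ∈ range (2 * c + 1), ((posClass I J K i j (2 * c - j - i)).filter p).card := by
  rw [card_eq_sum_card_fiberwise (f := I) (s := (posClassY J j).filter p) (t := range (2 * c + 1))]
  · refine sum_congr rfl fun i _ => ?_
    rw [filter_filter, ← filter_posClassY_eq_posClass h j i, filter_filter]
    congr 1
    ext t
    simp only [mem_filter, and_comm]
  · intro t ht
    rw [Finset.mem_coe, mem_filter] at ht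
    have := h t
    exact Finset.mem_coe.2 (mem_range.2 (by omega))

/-- In particular `|S_{*,j,*}| = ∑_i |S_{i,j,2c-j-i}|`. [cite: AlmanDuanVassilevskaWilliamsXuXuZhou2025, §5.3] -/
theorem card_posClassY_eq_sum {I J K : Fin n → ℕ} (h : IsLevelTriple c I J K) (j : ℕ) :
    (posClassY J j).card = ∑ i ∈ range (2 * c + 1), (posClass I J K i j (2 * c - j - i)).card := by
  have := card_filter_posClassY_eq_sum h j (fun _ => True)
  simpa using this

/-- **Fibrewise decomposition of `S_{*,j,+}`**: `#{t ∈ S_{*,j,+} | p t} = ∑_{i < 2c−j} #{t ∈ S_{i,j,2c-j-i} | p t}`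
(the classes with `k > 0`). [cite: AlmanDuanVassilevskaWilliamsXuXuZhou2025, Claim 5.18 (S_{*,j,+} = ⋃_{i≥0,k>0} S_{i,j,k})] -/
theorem card_filter_posClassYpos_eq_sum {I J K : Fin n → ℕ} (h : IsLevelTriple c I J K) (j : ℕ)
    (p : Fin n → Prop) [DecidablePred p] :
    ((posClassYpos J K j).filter p).card =
      ∑ i ∈ range (2 * c - j), ((posClass I J K i j (2 * c - j - i)).filter p).card := by
  rw [card_eq_sum_card_fiberwise (f := I) (s := (posClassYpos J K j).filter p) (t := range (2 * c - j))]
  · refine sum_congr rfl fun i hi => ?_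
    rw [filter_filter, ← filter_posClassYpos_eq_posClass h j (mem_range.1 hi), filter_filter]
    congr 1
    ext t
    simp only [mem_filter, and_comm]
  · intro t ht
    rw [Finset.mem_coe, mem_filter, mem_posClassYpos] at ht
    have := h t
    exact Finset.mem_coe.2 (mem_range.2 (by omega))

/-- In particular `|S_{*,j,+}| = ∑_{i<2c−j} |S_{i,j,2c-j-i}|`. [cite: AlmanDuanVassilevskaWilliamsXuXuZhou2025, Claim 5.18] -/
theorem card_posClassYpos_eq_sum {I J K : Fin n → ℕ} (h : IsLevelTriple c I J K) (j : ℕ) :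
    (posClassYpos J K j).card = ∑ i ∈ range (2 * c - j), (posClass I J K i j (2 * c - j - i)).card := by
  have := card_filter_posClassYpos_eq_sum h j (fun _ => True)
  simpa using this

/-- **`S_{*,j,*} = S_{*,j,+} ∪ S_{2c−j, j, 0}`** in a block triple (a position of `S_{*,j,*}` with
`K_t = 0` has `I_t = 2c − j`). [cite: AlmanDuanVassilevskaWilliamsXuXuZhou2025, Claim 5.17 (proof: "{S_{i,j,0}}_{i,j} ∪ {S_{*,j,+}}_j is a partition of [A₁n]")] -/
theorem posClassY_eq_union {I J K : Fin n → ℕ} (h : IsLevelTriple c I J K) (j : ℕ) :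
    posClassY J j = posClassYpos J K j ∪ posClass I J K (2 * c - j) j 0 := by
  ext t
  simp only [mem_union, mem_posClassY, mem_posClassYpos, mem_posClass]
  have := h t
  constructor
  · intro hj
    rcases Nat.eq_zero_or_pos (K t) with hk | hk
    · exact Or.inr ⟨by omega, hj, hk⟩
    · exact Or.inl ⟨hj, hk⟩
  · rintro (⟨hj, -⟩ | ⟨-, hj, -⟩) <;> exact hj

/-- The two parts are disjoint. [cite: AlmanDuanVassilevskaWilliamsXuXuZhou2025, Claim 5.17 (proof)] -/
theorem disjoint_posClassYpos_posClass (I J K : Fin n → ℕ) (j i : ℕ) :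
    Disjoint (posClassYpos J K j) (posClass I J K i j 0) := by
  rw [Finset.disjoint_left]
  intro t ht ht'
  rw [mem_posClassYpos] at ht
  rw [mem_posClass] at ht'
  omega

/-- Hence `#{t ∈ S_{*,j,*} | p t} = #{t ∈ S_{*,j,+} | p t} + #{t ∈ S_{2c−j,j,0} | p t}`. [cite: AlmanDuanVassilevskaWilliamsXuXuZhou2025, Claim 5.17 (proof)] -/
theorem card_filter_posClassY_eq_add {I J K : Fin n → ℕ} (h : IsLevelTriple c I J K) (j : ℕ)
    (p : Fin n → Prop) [DecidablePred p] :
    ((posClassY J j).filter p).card =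
      ((posClassYpos J K j).filter p).card + ((posClass I J K (2 * c - j) j 0).filter p).card := by
  rw [posClassY_eq_union h j, filter_union,
    card_union_of_disjoint (disjoint_filter_filter (disjoint_posClassYpos_posClass I J K j _))]

end PosClassY

/-! ## Split distributions on `S_{*,j,*}` and `S_{*,j,+}` -/

section SplitAvg

variable {c n : ℕ}

/-- **The averaging identity on `S_{*,j,*}`**:
`split(Ĵ, S_{*,j,*}) · |S_{*,j,*}| = ∑_i split(Ĵ, S_{i,j,2c-j-i}) · |S_{i,j,2c-j-i}|`.
[cite: AlmanDuanVassilevskaWilliamsXuXuZhou2025, Claim 5.12 (proof, the displayed computation)] -/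
theorem completeSplitOn_posClassY_mul_card {I J K : Fin n → ℕ} (h : IsLevelTriple c I J K)
    (Jh : Fin n → Fin c → Fin 3) (j : ℕ) (σ : Fin c → Fin 3) :
    completeSplitOn Jh (posClassY J j) σ * (posClassY J j).card =
      ∑ i ∈ range (2 * c + 1), completeSplitOn Jh (posClass I J K i j (2 * c - j - i)) σ *
        (posClass I J K i j (2 * c - j - i)).card := by
  rw [completeSplitOn_mul_card, card_filter_posClassY_eq_sum h j]
  push_cast
  exact sum_congr rfl fun i _ => (completeSplitOn_mul_card Jh _ σ).symm

/-- **The averaging identity on `S_{*,j,+}`**: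
`split(Ĵ, S_{*,j,+}) · |S_{*,j,+}| = ∑_{i<2c−j} split(Ĵ, S_{i,j,2c-j-i}) · |S_{i,j,2c-j-i}|`.
[cite: AlmanDuanVassilevskaWilliamsXuXuZhou2025, Claim 5.17 (proof)] -/
theorem completeSplitOn_posClassYpos_mul_card {I J K : Fin n → ℕ} (h : IsLevelTriple c I J K)
    (Jh : Fin n → Fin c → Fin 3) (j : ℕ) (σ : Fin c → Fin 3) :
    completeSplitOn Jh (posClassYpos J K j) σ * (posClassYpos J K j).card =
      ∑ i ∈ range (2 * c - j), completeSplitOn Jh (posClass I J K i j (2 * c - j - i)) σ *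
        (posClass I J K i j (2 * c - j - i)).card := by
  rw [completeSplitOn_mul_card, card_filter_posClassYpos_eq_sum h j]
  push_cast
  exact sum_congr rfl fun i _ => (completeSplitOn_mul_card Jh _ σ).symm

/-- The two-part form: `split(Ĵ, S_{*,j,*}) · |S_{*,j,*}| = split(Ĵ, S_{*,j,+}) · |S_{*,j,+}| + split(Ĵ, S_{2c−j,j,0}) · |S_{2c−j,j,0}|`.
[cite: AlmanDuanVassilevskaWilliamsXuXuZhou2025, Claim 5.17 (proof)] -/
theorem completeSplitOn_posClassY_mul_card_eq_add {I J K : Fin n → ℕ} (h : IsLevelTriple c I J K)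
    (Jh : Fin n → Fin c → Fin 3) (j : ℕ) (σ : Fin c → Fin 3) :
    completeSplitOn Jh (posClassY J j) σ * (posClassY J j).card =
      completeSplitOn Jh (posClassYpos J K j) σ * (posClassYpos J K j).card +
        completeSplitOn Jh (posClass I J K (2 * c - j) j 0) σ * (posClass I J K (2 * c - j) j 0).card := by
  rw [completeSplitOn_mul_card, completeSplitOn_mul_card, completeSplitOn_mul_card,
    card_filter_posClassY_eq_add h j]
  push_cast
  ring

end SplitAvg

/-! ## `β̄_{Y,*,j,*}`, `β̄_{Y,*,j,+}`; typicalness, compatibility, usefulness in the `Y`-dimension -/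

section Compatibility

variable {c n : ℕ}

/-- **`β̄_{Y,*,j,*} = (1/α(*,j,*)) ∑_{i+k=2^ℓ−j} α(i,j,k) · β_{Y,i,j,k}`**, the `α`-weighted average
complete split distribution of the constituent tensors with middle index `j` (sums over
`i ∈ {0,…,2c}`, `k = 2c − j − i` truncated in `ℕ`; the extra terms vanish for `α` supported on
`{i+j+k = 2c}`). [cite: AlmanDuanVassilevskaWilliamsXuXuZhou2025, §5 (notation f̄, "β̄_{X,*,+,k} = (1/α(*,+,k)) ∑ α(i,j,k) β_{X,i,j,k}") and Def. 5.13] -/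
def gammaBarY (c : ℕ) (α : ℕ × ℕ × ℕ → ℝ) (γY : ℕ × ℕ × ℕ → (Fin c → Fin 3) → ℝ) (j : ℕ) :
    (Fin c → Fin 3) → ℝ := fun σ =>
  (∑ i ∈ range (2 * c + 1), α (i, j, 2 * c - j - i) * γY (i, j, 2 * c - j - i) σ) /
    ∑ i ∈ range (2 * c + 1), α (i, j, 2 * c - j - i)

/-- **`β̄_{Y,*,j,+} = (1/α(*,j,+)) ∑_{i ≥ 0, k > 0} α(i,j,k) · β_{Y,i,j,k}`** (`k = 2c − j − i > 0` iff
`i < 2c − j`). [cite: AlmanDuanVassilevskaWilliamsXuXuZhou2025, Claim 5.17 (η_Y) and Claim 5.18] -/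
def gammaBarYpos (c : ℕ) (α : ℕ × ℕ × ℕ → ℝ) (γY : ℕ × ℕ × ℕ → (Fin c → Fin 3) → ℝ) (j : ℕ) :
    (Fin c → Fin 3) → ℝ := fun σ =>
  (∑ i ∈ range (2 * c - j), α (i, j, 2 * c - j - i) * γY (i, j, 2 * c - j - i) σ) /
    ∑ i ∈ range (2 * c - j), α (i, j, 2 * c - j - i)

/-- **Def. 5.13 (`Y`-typicalness)**: `Y_Ĵ ∈ Y_J` is typical if `split(Ĵ, S_{*,j,*}) = β̄_{Y,*,j,*}` for
every (occurring) `j`. [cite: AlmanDuanVassilevskaWilliamsXuXuZhou2025, Def. 5.13] -/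
def IsTypicalY (c : ℕ) (α : ℕ × ℕ × ℕ → ℝ) (γY : ℕ × ℕ × ℕ → (Fin c → Fin 3) → ℝ) (J : Fin n → ℕ)
    (Jh : Fin n → Fin c → Fin 3) : Prop :=
  ∀ j, (posClassY J j).Nonempty → completeSplitOn Jh (posClassY J j) = gammaBarY c α γY j

/-- **Def. 5.6 (`Y`-compatibility)**: `Y_Ĵ ∈ Y_J` is compatible with the triple `X_I Y_J Z_K` if
(1) `split(Ĵ, S_{i,j,k}) = β_{Y,i,j,k}` for all (occurring) `(i,j,k)` with `k = 0`, and
(2) `split(Ĵ, S_{*,j,*}) = β̄_{Y,*,j,*}` for every `j`. [cite: AlmanDuanVassilevskaWilliamsXuXuZhou2025, Def. 5.6] -/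
def IsYCompatibleWith (c : ℕ) (α : ℕ × ℕ × ℕ → ℝ) (γY : ℕ × ℕ × ℕ → (Fin c → Fin 3) → ℝ)
    (I J K : Fin n → ℕ) (Jh : Fin n → Fin c → Fin 3) : Prop :=
  (∀ i j k, k = 0 → (posClass I J K i j k).Nonempty → completeSplitOn Jh (posClass I J K i j k) = γY (i, j, k)) ∧
    IsTypicalY c α γY J Jh

/-- **Def. 5.8 (`Y`-usefulness)** is `IsUsefulFor β_Y I J K Ĵ`: `split(Ĵ, S_{i,j,k}) = β_{Y,i,j,k}` for
every (occurring) `i, j, k`. [cite: AlmanDuanVassilevskaWilliamsXuXuZhou2025, Def. 5.8] -/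
theorem isUsefulFor_iff_y (γY : ℕ × ℕ × ℕ → (Fin c → Fin 3) → ℝ) (I J K : Fin n → ℕ) (Jh : Fin n → Fin c → Fin 3) :
    IsUsefulFor γY I J K Jh ↔
      ∀ i j k, (posClass I J K i j k).Nonempty → completeSplitOn Jh (posClass I J K i j k) = γY (i, j, k) :=
  Iff.rfl

/-- In an `α`-consistent triple the class masses are `|S_{i,j,2c-j-i}| = α(i,j,2c-j-i) · n`, so
`|S_{*,j,*}| = α(*,j,*) · n` (sum over `i ≤ 2c`). [cite: AlmanDuanVassilevskaWilliamsXuXuZhou2025, §5.2 ("consistent with α") and Claim 5.4] -/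
theorem card_posClassY_eq_alpha_mul {α : ℕ × ℕ × ℕ → ℝ} {I J K : Fin n → ℕ} (hlev : IsLevelTriple c I J K)
    (hα : IsAlphaConsistent α I J K) (j : ℕ) :
    ((posClassY J j).card : ℝ) = (∑ i ∈ range (2 * c + 1), α (i, j, 2 * c - j - i)) * n := by
  rw [card_posClassY_eq_sum hlev j]
  push_cast
  rw [sum_mul]
  exact sum_congr rfl fun i _ => hα _ _ _

/-- Likewise `|S_{*,j,+}| = α(*,j,+) · n` (sum over `i < 2c − j`). [cite: AlmanDuanVassilevskaWilliamsXuXuZhou2025, Claim 5.17 (proof)] -/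
theorem card_posClassYpos_eq_alpha_mul {α : ℕ × ℕ × ℕ → ℝ} {I J K : Fin n → ℕ} (hlev : IsLevelTriple c I J K)
    (hα : IsAlphaConsistent α I J K) (j : ℕ) :
    ((posClassYpos J K j).card : ℝ) = (∑ i ∈ range (2 * c - j), α (i, j, 2 * c - j - i)) * n := by
  rw [card_posClassYpos_eq_sum hlev j]
  push_cast
  rw [sum_mul]
  exact sum_congr rfl fun i _ => hα _ _ _

/-- The summands of the averaging identity on the classes where the split distribution is the
prescribed one: `split(Ĵ, S_i) · |S_i| = α_i · β_i · n` whenever `split(Ĵ, S_i) = β_i` or `S_i = ∅`.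
[cite: AlmanDuanVassilevskaWilliamsXuXuZhou2025, Claim 5.12 (proof)] -/
theorem completeSplitOn_mul_card_eq_of_useful {α : ℕ × ℕ × ℕ → ℝ} {γY : ℕ × ℕ × ℕ → (Fin c → Fin 3) → ℝ}
    {I J K : Fin n → ℕ} (hα : IsAlphaConsistent α I J K) {Jh : Fin n → Fin c → Fin 3} {i j k : ℕ}
    (hu : (posClass I J K i j k).Nonempty → completeSplitOn Jh (posClass I J K i j k) = γY (i, j, k))
    (σ : Fin c → Fin 3) :
    completeSplitOn Jh (posClass I J K i j k) σ * (posClass I J K i j k).card = α (i, j, k) * γY (i, j, k) σ * n := by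
  rcases (posClass I J K i j k).eq_empty_or_nonempty with he | hne
  · have h0 : α (i, j, k) * n = 0 := by rw [← hα, he, card_empty, Nat.cast_zero]
    rw [he, card_empty, Nat.cast_zero, mul_zero, mul_assoc, mul_comm (γY _ σ), ← mul_assoc, h0, zero_mul]
  · rw [hu hne, hα]
    ring

/-- **A `Y`-useful block of an `α`-consistent triple is `Y`-typical** ("condition (3) is strictly
stronger than condition (1)": `split(Ĵ, S_{*,j,*}) = (1/∑_{i,k} α(i,j,k)) ∑ α(i,j,k) split(Ĵ, S_{i,j,k})
= (1/∑ α) ∑ α(i,j,k) β_{Y,i,j,k} = β̄_{Y,*,j,*}`). [cite: AlmanDuanVassilevskaWilliamsXuXuZhou2025, Claim 5.12 (proof)] -/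
theorem IsUsefulFor.isTypicalY {α : ℕ × ℕ × ℕ → ℝ} {γY : ℕ × ℕ × ℕ → (Fin c → Fin 3) → ℝ}
    {I J K : Fin n → ℕ} {Jh : Fin n → Fin c → Fin 3} (hlev : IsLevelTriple c I J K)
    (hα : IsAlphaConsistent α I J K) (hu : IsUsefulFor γY I J K Jh) : IsTypicalY c α γY J Jh := by
  intro j hj
  funext σ
  have hn : (n : ℝ) ≠ 0 := by
    obtain ⟨t, _⟩ := hj
    have : 0 < n := Fin.pos t
    exact_mod_cast this.ne'
  have hcardY := card_posClassY_eq_alpha_mul hlev hα j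
  have hpos : (0 : ℝ) < (posClassY J j).card := by exact_mod_cast hj.card_pos
  have hden : (∑ i ∈ range (2 * c + 1), α (i, j, 2 * c - j - i)) ≠ 0 := by
    intro h0
    rw [h0, zero_mul] at hcardY
    exact hpos.ne' hcardY
  have havg := completeSplitOn_posClassY_mul_card hlev Jh j σ
  have hterm : ∀ i ∈ range (2 * c + 1),
      completeSplitOn Jh (posClass I J K i j (2 * c - j - i)) σ * (posClass I J K i j (2 * c - j - i)).card =
        α (i, j, 2 * c - j - i) * γY (i, j, 2 * c - j - i) σ * n :=
    fun i _ => completeSplitOn_mul_card_eq_of_useful hα (hu i j (2 * c - j - i)) σ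
  rw [sum_congr rfl hterm, hcardY, ← sum_mul, ← mul_assoc] at havg
  have := mul_right_cancel₀ hn havg
  simp only [gammaBarY]
  rw [eq_div_iff hden]
  exact this

/-- Hence **a `Y`-useful block of an `α`-consistent triple is `Y`-compatible with it**. [cite: AlmanDuanVassilevskaWilliamsXuXuZhou2025, Claim 5.12 (proof)] -/
theorem IsUsefulFor.isYCompatibleWith {α : ℕ × ℕ × ℕ → ℝ} {γY : ℕ × ℕ × ℕ → (Fin c → Fin 3) → ℝ}
    {I J K : Fin n → ℕ} {Jh : Fin n → Fin c → Fin 3} (hlev : IsLevelTriple c I J K)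
    (hα : IsAlphaConsistent α I J K) (hu : IsUsefulFor γY I J K Jh) : IsYCompatibleWith c α γY I J K Jh :=
  ⟨fun i j k _ hne => hu i j k hne, hu.isTypicalY hlev hα⟩

/-- A `Y`-compatible block is `Y`-typical. [cite: AlmanDuanVassilevskaWilliamsXuXuZhou2025, Def. 5.6 (item 2)] -/
theorem IsYCompatibleWith.isTypicalY {α : ℕ × ℕ × ℕ → ℝ} {γY : ℕ × ℕ × ℕ → (Fin c → Fin 3) → ℝ}
    {I J K : Fin n → ℕ} {Jh : Fin n → Fin c → Fin 3} (h : IsYCompatibleWith c α γY I J K Jh) :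
    IsTypicalY c α γY J Jh :=
  h.2

end Compatibility

/-! ## Claim 5.7: after the first zero-outs every level-1 `Y`-block is compatible with its triples -/

section Claim57

variable (K : Type u) [CommSemiring K] (q : ℕ) {c n : ℕ}

/-- **Claim 5.7, the core**: in the support of the power, on a chunk where the `Z`-block has level `0`
the level-1 `Ĵ`-chunk is `2⃗ −` the `Î`-chunk ("since `k = 0`, we have `K_t = 0` for all `t ∈ S_{i,j,k}`,
i.e. `(K̂_{…}) = 0⃗` … so `(Ĵ_{…}) = 2⃗ − (Î_{…})`"). [cite: AlmanDuanVassilevskaWilliamsXuXuZhou2025, Claim 5.7 (proof)] -/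
theorem levelSeq_y_eq_rev_of_chunkLevels_z_eq_zero {x y z : Fin n → Fin c → Fin (q + 2)}
    (h : kroneckerPow (kroneckerPow (bigCwTensor K q) c) n x y z ≠ 0) {t : Fin n}
    (ht : chunkLevels (levelSeq z) t = 0) : levelSeq y t = fun p => (levelSeq x t p).rev := by
  funext p
  have h0 : levelSeq z t p = 0 := pattern_eq_zero_of_patternLevel_eq_zero (by simpa using ht) p
  have h2 := levelSeq_add_of_ne_zero K q h t p
  rw [h0] at h2
  apply Fin.ext
  rw [Fin.val_rev]
  have := (levelSeq x t p).isLt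
  have := (levelSeq y t p).isLt
  simp only [Fin.val_zero, add_zero] at h2
  omega

/-- **Claim 5.7, as split distributions**: in the support of the power with block triple `(I, J, K)`,
`split(Ĵ, S_{i,j,0})(L) = split(Î, S_{i,j,0})(2⃗ − L)`. [cite: AlmanDuanVassilevskaWilliamsXuXuZhou2025, Claim 5.7 (proof: "split(Ĵ, S_{i,j,k})(L) = split(Î, S_{i,j,k})(2⃗ − L)")] -/
theorem completeSplitOn_y_eq_rev_of_k_eq_zero {x y z : Fin n → Fin c → Fin (q + 2)}
    (h : kroneckerPow (kroneckerPow (bigCwTensor K q) c) n x y z ≠ 0) (i j : ℕ) (σ : Fin c → Fin 3) :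
    completeSplitOn (levelSeq y)
        (posClass (chunkLevels (levelSeq x)) (chunkLevels (levelSeq y)) (chunkLevels (levelSeq z)) i j 0) σ =
      completeSplitOn (levelSeq x)
        (posClass (chunkLevels (levelSeq x)) (chunkLevels (levelSeq y)) (chunkLevels (levelSeq z)) i j 0)
        (fun p => (σ p).rev) :=
  completeSplitOn_rev_on
    (fun _ ht => levelSeq_y_eq_rev_of_chunkLevels_z_eq_zero K q h (mem_posClass.1 ht).2.2) σ

/-- **Claim 5.7, item (1) of `Y`-compatibility**: in the support of the power with block triple
`(I, J, K)`, if `Î` is useful for the `X`-data (the first zero-out of §5.3: "if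
`split(Î, S_{i,j,k}) ≠ β_{X,i,j,k}` we zero out `X_Î`") and the `Y`-data satisfies Remark 5.2's
convention `β_{Y,i,j,0}(L) = β_{X,i,j,0}(2⃗ − L)`, then `split(Ĵ, S_{i,j,k}) = β_{Y,i,j,k}` for every
occurring class with `k = 0`. [cite: AlmanDuanVassilevskaWilliamsXuXuZhou2025, Claim 5.7] -/
theorem yCompatible_fst_of_usefulX {γX γY : ℕ × ℕ × ℕ → (Fin c → Fin 3) → ℝ}
    (hYX : ∀ i j σ, γY (i, j, 0) σ = γX (i, j, 0) (fun p => (σ p).rev))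
    {x y z : Fin n → Fin c → Fin (q + 2)}
    (h : kroneckerPow (kroneckerPow (bigCwTensor K q) c) n x y z ≠ 0)
    (hx : IsUsefulFor γX (chunkLevels (levelSeq x)) (chunkLevels (levelSeq y)) (chunkLevels (levelSeq z)) (levelSeq x))
    (i j k : ℕ) (hk : k = 0)
    (hne : (posClass (chunkLevels (levelSeq x)) (chunkLevels (levelSeq y)) (chunkLevels (levelSeq z)) i j k).Nonempty) :
    completeSplitOn (levelSeq y)
        (posClass (chunkLevels (levelSeq x)) (chunkLevels (levelSeq y)) (chunkLevels (levelSeq z)) i j k) =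
      γY (i, j, k) := by
  subst hk
  funext σ
  rw [completeSplitOn_y_eq_rev_of_k_eq_zero K q h i j σ, hx i j 0 hne, hYX]

/-- **ADVXXZ Claim 5.7**: "In `𝒯_YComp`, for every level-1 block triple `X_Î Y_Ĵ Z_K̂` and the level-`ℓ`
block triple `X_I Y_J Z_K` that contains it, `Y_Ĵ` is compatible with `X_I Y_J Z_K`" — the remaining
`X_Î` being useful (first zero-out of §5.3) and the remaining `Y_Ĵ` typical (`Y`-compatibility
zero-out I), under Remark 5.2's convention on `β_Y`. [cite: AlmanDuanVassilevskaWilliamsXuXuZhou2025, Claim 5.7] -/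
theorem advxxz2025_claim57 {α : ℕ × ℕ × ℕ → ℝ} {γX γY : ℕ × ℕ × ℕ → (Fin c → Fin 3) → ℝ}
    (hYX : ∀ i j σ, γY (i, j, 0) σ = γX (i, j, 0) (fun p => (σ p).rev))
    {x y z : Fin n → Fin c → Fin (q + 2)}
    (h : kroneckerPow (kroneckerPow (bigCwTensor K q) c) n x y z ≠ 0)
    (hx : IsUsefulFor γX (chunkLevels (levelSeq x)) (chunkLevels (levelSeq y)) (chunkLevels (levelSeq z)) (levelSeq x))
    (hy : IsTypicalY c α γY (chunkLevels (levelSeq y)) (levelSeq y)) :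
    IsYCompatibleWith c α γY (chunkLevels (levelSeq x)) (chunkLevels (levelSeq y)) (chunkLevels (levelSeq z))
      (levelSeq y) :=
  ⟨fun i j k hk hne => yCompatible_fst_of_usefulX K q hYX h hx i j k hk hne, hy⟩

end Claim57

/-! ## Claim 5.18: compatibility in terms of `S_{*,j,+}` -/

section Claim518

variable {c n : ℕ}

/-- The defect of a class: `(split(Ĵ, S_{i,j,k})(σ) − β_{Y,i,j,k}(σ)) · |S_{i,j,k}|`; it vanishes when the
class is empty or carries the prescribed split distribution. [cite: AlmanDuanVassilevskaWilliamsXuXuZhou2025, Claim 5.18 (proof sketch: "similar to … Claim 5.14 in [VXXZ24]")] -/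
theorem sub_mul_card_eq_zero_of_useful {γY : ℕ × ℕ × ℕ → (Fin c → Fin 3) → ℝ} {I J K : Fin n → ℕ}
    {Jh : Fin n → Fin c → Fin 3} {i j k : ℕ}
    (hu : (posClass I J K i j k).Nonempty → completeSplitOn Jh (posClass I J K i j k) = γY (i, j, k))
    (σ : Fin c → Fin 3) :
    (completeSplitOn Jh (posClass I J K i j k) σ - γY (i, j, k) σ) * (posClass I J K i j k).card = 0 := by
  rcases (posClass I J K i j k).eq_empty_or_nonempty with he | hne
  · rw [he, card_empty, Nat.cast_zero, mul_zero]
  · rw [hu hne, sub_self, zero_mul]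

/-- **Typicalness at `j` as a vanishing total defect**: for an `α`-consistent block triple,
`split(Ĵ, S_{*,j,*}) = β̄_{Y,*,j,*}` (when `S_{*,j,*} ≠ ∅`) iff
`∑_{i ≤ 2c} (split(Ĵ, S_{i,j,2c-j-i}) − β_{Y,i,j,2c-j-i}) · |S_{i,j,2c-j-i}| = 0` pointwise.
[cite: AlmanDuanVassilevskaWilliamsXuXuZhou2025, Claim 5.12 (proof) and Claim 5.18] -/
theorem typicalY_at_iff_sum_eq_zero {α : ℕ × ℕ × ℕ → ℝ} {γY : ℕ × ℕ × ℕ → (Fin c → Fin 3) → ℝ}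
    {I J K : Fin n → ℕ} (hlev : IsLevelTriple c I J K) (hα : IsAlphaConsistent α I J K)
    (Jh : Fin n → Fin c → Fin 3) {j : ℕ} (hj : (posClassY J j).Nonempty) :
    completeSplitOn Jh (posClassY J j) = gammaBarY c α γY j ↔
      ∀ σ, ∑ i ∈ range (2 * c + 1), (completeSplitOn Jh (posClass I J K i j (2 * c - j - i)) σ -
        γY (i, j, 2 * c - j - i) σ) * (posClass I J K i j (2 * c - j - i)).card = 0 := by
  have hn : (n : ℝ) ≠ 0 := by
    obtain ⟨t, _⟩ := hj
    have : 0 < n := Fin.pos t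
    exact_mod_cast this.ne'
  have hcardY := card_posClassY_eq_alpha_mul hlev hα j
  have hpos : (0 : ℝ) < (posClassY J j).card := by exact_mod_cast hj.card_pos
  have hden : (∑ i ∈ range (2 * c + 1), α (i, j, 2 * c - j - i)) ≠ 0 := by
    intro h0
    rw [h0, zero_mul] at hcardY
    exact hpos.ne' hcardY
  -- the defect sum is `split(Ĵ,S)·|S| − n · ∑ α_i β_i`
  have hdef : ∀ σ, ∑ i ∈ range (2 * c + 1), (completeSplitOn Jh (posClass I J K i j (2 * c - j - i)) σ -
      γY (i, j, 2 * c - j - i) σ) * (posClass I J K i j (2 * c - j - i)).card =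
      completeSplitOn Jh (posClassY J j) σ * (posClassY J j).card -
        (∑ i ∈ range (2 * c + 1), α (i, j, 2 * c - j - i) * γY (i, j, 2 * c - j - i) σ) * n := by
    intro σ
    rw [completeSplitOn_posClassY_mul_card hlev Jh j σ, sum_mul, ← sum_sub_distrib]
    refine sum_congr rfl fun i _ => ?_
    rw [sub_mul, hα]
    ring
  constructor
  · intro htyp σ
    rw [hdef σ, htyp, hcardY]
    simp only [gammaBarY]
    rw [div_mul_eq_mul_div, mul_div_assoc, mul_div_cancel_left₀ _ hden, sub_self]
  · intro hsum
    funext σ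
    have h0 := hsum σ
    rw [hdef σ, sub_eq_zero, hcardY, ← mul_assoc] at h0
    have h1 := mul_right_cancel₀ hn h0
    simp only [gammaBarY]
    rw [eq_div_iff hden]
    exact h1

/-- **The `S_{*,j,+}`-condition as a vanishing partial defect**: for an `α`-consistent block triple,
`split(Ĵ, S_{*,j,+}) = β̄_{Y,*,j,+}` (when `S_{*,j,+} ≠ ∅`) iff
`∑_{i < 2c−j} (split(Ĵ, S_{i,j,2c-j-i}) − β_{Y,i,j,2c-j-i}) · |S_{i,j,2c-j-i}| = 0` pointwise; and when
`S_{*,j,+} = ∅` the partial defect vanishes anyway. [cite: AlmanDuanVassilevskaWilliamsXuXuZhou2025, Claim 5.18] -/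
theorem posCond_at_iff_sum_eq_zero {α : ℕ × ℕ × ℕ → ℝ} {γY : ℕ × ℕ × ℕ → (Fin c → Fin 3) → ℝ}
    {I J K : Fin n → ℕ} (hlev : IsLevelTriple c I J K) (hα : IsAlphaConsistent α I J K)
    (Jh : Fin n → Fin c → Fin 3) (j : ℕ) :
    ((posClassYpos J K j).Nonempty → completeSplitOn Jh (posClassYpos J K j) = gammaBarYpos c α γY j) ↔
      ∀ σ, ∑ i ∈ range (2 * c - j), (completeSplitOn Jh (posClass I J K i j (2 * c - j - i)) σ -
        γY (i, j, 2 * c - j - i) σ) * (posClass I J K i j (2 * c - j - i)).card = 0 := by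
  have hcardP := card_posClassYpos_eq_alpha_mul hlev hα j
  have hdef : ∀ σ, ∑ i ∈ range (2 * c - j), (completeSplitOn Jh (posClass I J K i j (2 * c - j - i)) σ -
      γY (i, j, 2 * c - j - i) σ) * (posClass I J K i j (2 * c - j - i)).card =
      completeSplitOn Jh (posClassYpos J K j) σ * (posClassYpos J K j).card -
        (∑ i ∈ range (2 * c - j), α (i, j, 2 * c - j - i) * γY (i, j, 2 * c - j - i) σ) * n := by
    intro σ
    rw [completeSplitOn_posClassYpos_mul_card hlev Jh j σ, sum_mul, ← sum_sub_distrib]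
    refine sum_congr rfl fun i _ => ?_
    rw [sub_mul, hα]
    ring
  rcases (posClassYpos J K j).eq_empty_or_nonempty with he | hP
  · -- empty: both sides hold
    have hcard0 : ∀ i ∈ range (2 * c - j), (posClass I J K i j (2 * c - j - i)).card = 0 := by
      intro i hi
      have hsub : posClass I J K i j (2 * c - j - i) ⊆ posClassYpos J K j := by
        rw [← filter_posClassYpos_eq_posClass hlev j (mem_range.1 hi)]
        exact filter_subset _ _
      rw [he] at hsub
      exact card_eq_zero.2 (subset_empty.1 hsub)
    constructor
    · intro _ σ
      exact sum_eq_zero fun i hi => by rw [hcard0 i hi, Nat.cast_zero, mul_zero]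
    · intro _ hne
      rw [he] at hne
      exact absurd hne Finset.not_nonempty_empty
  · have hn : (n : ℝ) ≠ 0 := by
      obtain ⟨t, _⟩ := hP
      have : 0 < n := Fin.pos t
      exact_mod_cast this.ne'
    have hpos : (0 : ℝ) < (posClassYpos J K j).card := by exact_mod_cast hP.card_pos
    have hden : (∑ i ∈ range (2 * c - j), α (i, j, 2 * c - j - i)) ≠ 0 := by
      intro h0
      rw [h0, zero_mul] at hcardP
      exact hpos.ne' hcardP
    constructor
    · intro hcond σ
      rw [hdef σ, hcond hP, hcardP]
      simp only [gammaBarYpos]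
      rw [div_mul_eq_mul_div, mul_div_assoc, mul_div_cancel_left₀ _ hden, sub_self]
    · intro hsum _
      funext σ
      have h0 := hsum σ
      rw [hdef σ, sub_eq_zero, hcardP, ← mul_assoc] at h0
      have h1 := mul_right_cancel₀ hn h0
      simp only [gammaBarYpos]
      rw [eq_div_iff hden]
      exact h1

/-- **ADVXXZ Claim 5.18**: "Given a level-`ℓ` triple `X_I Y_J Z_K` that is consistent with `α`, a
level-1 block `Y_Ĵ` with `Ĵ ∈ J` is compatible with `X_I Y_J Z_K` if and only if: (1) for every
`(i,j,k)` with `i+j+k = 2^ℓ` and `k = 0`, `split(Ĵ, S_{i,j,k}) = β_{Y,i,j,k}`; (2) for `j ∈ {0,…,2^ℓ}`,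
`split(Ĵ, S_{*,j,+}) = β̄_{Y,*,j,+}` where `S_{*,j,+} = ⋃_{i ≥ 0, k > 0} S_{i,j,k}`" (conditions on
occurring classes). [cite: AlmanDuanVassilevskaWilliamsXuXuZhou2025, Claim 5.18] -/
theorem advxxz2025_claim518 {α : ℕ × ℕ × ℕ → ℝ} {γY : ℕ × ℕ × ℕ → (Fin c → Fin 3) → ℝ}
    {I J K : Fin n → ℕ} (hlev : IsLevelTriple c I J K) (hα : IsAlphaConsistent α I J K)
    (Jh : Fin n → Fin c → Fin 3) :
    IsYCompatibleWith c α γY I J K Jh ↔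
      (∀ i j k, k = 0 → (posClass I J K i j k).Nonempty → completeSplitOn Jh (posClass I J K i j k) = γY (i, j, k)) ∧
        ∀ j, (posClassYpos J K j).Nonempty → completeSplitOn Jh (posClassYpos J K j) = gammaBarYpos c α γY j := by
  -- under (1), the defects of the classes with `k = 0`, i.e. `i ≥ 2c − j`, vanish
  have hzero : (∀ i j k, k = 0 → (posClass I J K i j k).Nonempty →
      completeSplitOn Jh (posClass I J K i j k) = γY (i, j, k)) → ∀ j σ,
      ∑ i ∈ Ico (2 * c - j) (2 * c + 1), (completeSplitOn Jh (posClass I J K i j (2 * c - j - i)) σ -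
        γY (i, j, 2 * c - j - i) σ) * (posClass I J K i j (2 * c - j - i)).card = 0 := by
    intro h1 j σ
    refine sum_eq_zero fun i hi => ?_
    have hk : 2 * c - j - i = 0 := by have := (mem_Ico.1 hi).1; omega
    exact sub_mul_card_eq_zero_of_useful (h1 i j _ hk) σ
  -- splitting the total defect at `2c − j`
  have hsplit : ∀ j σ, ∑ i ∈ range (2 * c + 1), (completeSplitOn Jh (posClass I J K i j (2 * c - j - i)) σ -
        γY (i, j, 2 * c - j - i) σ) * (posClass I J K i j (2 * c - j - i)).card =
      ∑ i ∈ range (2 * c - j), (completeSplitOn Jh (posClass I J K i j (2 * c - j - i)) σ -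
        γY (i, j, 2 * c - j - i) σ) * (posClass I J K i j (2 * c - j - i)).card +
      ∑ i ∈ Ico (2 * c - j) (2 * c + 1), (completeSplitOn Jh (posClass I J K i j (2 * c - j - i)) σ -
        γY (i, j, 2 * c - j - i) σ) * (posClass I J K i j (2 * c - j - i)).card := by
    intro j σ
    exact (sum_range_add_sum_Ico _ (by omega)).symm
  constructor
  · rintro ⟨h1, htyp⟩
    refine ⟨h1, fun j => ?_⟩
    rw [posCond_at_iff_sum_eq_zero hlev hα Jh j]
    intro σ
    rcases (posClassY J j).eq_empty_or_nonempty with he | hne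
    · -- no position with `J_t = j`: all classes empty
      refine sum_eq_zero fun i _ => ?_
      have hsub := posClass_subset_posClassY I J K i j (2 * c - j - i)
      rw [he] at hsub
      rw [card_eq_zero.2 (subset_empty.1 hsub), Nat.cast_zero, mul_zero]
    · have htot := (typicalY_at_iff_sum_eq_zero hlev hα Jh hne).1 (htyp j hne) σ
      rw [hsplit j σ, hzero h1 j σ, add_zero] at htot
      exact htot
  · rintro ⟨h1, hcond⟩
    refine ⟨h1, fun j hne => ?_⟩
    rw [typicalY_at_iff_sum_eq_zero hlev hα Jh hne]
    intro σ
    rw [hsplit j σ, hzero h1 j σ, add_zero]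
    exact (posCond_at_iff_sum_eq_zero hlev hα Jh j).1 (hcond j) σ

end Claim518

end Literature.Computability.AlgebraicComplexity
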